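import Summits.ABC.ABC.Theorems.DefiniteXiFreyModularityStubAbsIrrNegThree
import Literature.NumberTheory.DiophantineGeometry.GeneralizedFermatTwoPowerCoefficientFreyProofs
import Literature.NumberTheory.Automorphic.CDTTheorem722
import Literature.NumberTheory.GaloisRepresentations.BlochKatoSelmerGroup
import Literature.NumberTheory.GaloisRepresentations.SelmerStructureLocalIndexProofs
import HarnessLib

/-!
# `stub_liftThree` — ideator k3 (GEN 13), HOME FAMILY 3 "probe the extremes": typed companion

Companion of `STUB-IDEAS-stub_liftThree-3.md` (gen 13).  Self-contained: imports only landed files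
(no `Cruxes/` module).  Crux `FreyModularity` (item `stmt-ABC-11340`), line `Lines/Sketch.lean`, stub
  `stub_liftThree : ∀ W [IsElliptic] ρ, W.IsTorsionGaloisRep 3 ρ → ρ.IsAbsIrreducibleOverSqrt (-3) →
     ¬ 9 ∣ N_W → ρ.IsModular → W.IsModularGaloisRepTate 3`.

New here (gen 13): the CONSUMPTION CENSUS of the two lifting stubs of the line.  The route's only
free parameter is the switch curve `E'`; pushing every consumed instance of `stub_liftThree` /
`stub_liftFive` to an extreme local cell at `ℓ = 3, 5` one finds that the peu-ramifié cell
  `β₀(ℓ) := {W multiplicative at ℓ, ℓ ∣ ord_ℓ Δ_min(W)}`   (`ρ̄|G_ℓ` good AND ordinary, `ρ_{W,ℓ}` not good: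
  DDT 1995 Def. 3.25, Prop. 2.27(b), the `Σ`-increment at `q = ℓ` with `c_ℓ`)
is forced on the route at ONE of the two primes by a single Frey curve lying in `β₀(3) ∩ β₀(5)`:
  `E_(27, 3098)`, `27 + 3098 = 3125 = 5⁵`, `abc = 2 · 3³ · 5⁵ · 1549`, `ord₃ Δ_min = 6`, `ord₅ Δ_min = 10`.
Hence the `q = ℓ` step (gen-12 H12.3) is on the critical path of the ROUTE, whichever road
(`3` = case A, or `5` = switch) the glue sends this curve down, and should be typed ONCE, uniformly
in `ℓ` (C2 below: `LiftBeta0 ℓ d`, whose instances `ℓ = 3, d = -3` and `ℓ = 5, d = 5` are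
weakenings of the two registered stubs — no costume).
Contents: C0 uniform cell + glue from both registered stubs (kernel-checked); C1 arithmetic
certificate of `(27, 3098, 3125)`; C2 `E_(27,3098) ∈ β₀(3) ∩ β₀(5)`; C3 the Hasse-interval
arithmetic behind the `a₃`-rigidity of the switch (`a₃(E') ≡ a₃(E) (mod 5)`, `|a₃| ≤ 3`).
-/

noncomputable section

open scoped MatrixGroups NumberField
open IsDedekindDomain WeierstrassCurve Rat.HeightOneSpectrum
open Literature.NumberTheory.EllipticCurves
open Literature.NumberTheory.Automorphic Literature.NumberTheory.Automorphic.BCDT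
open Literature.NumberTheory.GaloisRepresentations
open Literature.NumberTheory.DiophantineGeometry
open Summit.ABC.ABC.Theorems

namespace Summit.ABC.ABC.Cruxes.FreyModularity.StubIdeas3G13

/-! ## C0. The peu-ramifié cell `β₀(ℓ)`, uniformly in `ℓ` (tree vocabulary only) -/

/-- The registered `stub_liftThree`, verbatim. -/
def LiftThree : Prop :=
  ∀ (W : WeierstrassCurve ℚ) [W.IsElliptic] (ρ : ModPGaloisRep ℚ (ZMod 3) 2),
    W.IsTorsionGaloisRep 3 ρ → ρ.IsAbsIrreducibleOverSqrt (-3) → ¬ 9 ∣ W.conductorNorm ℤ →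
      ρ.IsModular → W.IsModularGaloisRepTate 3

/-- The registered `stub_liftFive`, verbatim. -/
def LiftFive : Prop :=
  ∀ (W : WeierstrassCurve ℚ) [W.IsElliptic] (ρ : ModPGaloisRep ℚ (ZMod 5) 2),
    W.IsTorsionGaloisRep 5 ρ → ρ.IsAbsIrreducibleOverSqrt 5 → ¬ 25 ∣ W.conductorNorm ℤ →
      ρ.IsModular → W.IsModularGaloisRepTate 5

/-- **Cell `β₀(ℓ)`, uniform in the prime `ℓ`** (`d` = the quadratic field parameter of the stub,
`-3` at `ℓ = 3`, `5` at `ℓ = 5`): the lifting statement restricted to curves multiplicative at the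
place above `ℓ` with `ℓ ∣ ord_ℓ Δ_min` — `E[ℓ]|_{D_ℓ}` finite flat (peu ramifié Tate curve) and
ordinary, `T_ℓ E` ordinary not crystalline: the one cell where the `ρ̄`-minimal condition at `ℓ`
("good", DDT Def. 3.25: `ℓ ∈ Σ_ρ̄`) excludes `ρ_{E,ℓ}` and the induction must enlarge `Σ` at
`q = ℓ` (DDT Prop. 2.27(b), Thm. 3.36 with `c_ℓ`, p. 133 "the case `p = ℓ` is similar but simpler").
[cite: DDT1995, Def. 3.25, Prop. 2.27(b), Thm. 3.36] -/
def LiftBeta0 (ℓ : ℕ) [Fact ℓ.Prime] (d : ℚ) : Prop :=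
  ∀ (W : WeierstrassCurve ℚ) [W.IsElliptic] (ρ : ModPGaloisRep ℚ (ZMod ℓ) 2),
    W.IsTorsionGaloisRep ℓ ρ → ρ.IsAbsIrreducibleOverSqrt d → ¬ ℓ ^ 2 ∣ W.conductorNorm ℤ →
      ρ.IsModular → ∀ v : HeightOneSpectrum ℤ, natGenerator v = ℓ →
        W.HasMultiplicativeReductionAt v → ℓ ∣ W.ordMinimalDiscriminant v →
          W.IsModularGaloisRepTate ℓ

/-- No costume: `β₀(3)` is a weakening of the registered `stub_liftThree` (and is, up to
`9 = 3 ^ 2`, gen-12's `LiftThreeBeta0`). -/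
theorem liftBeta0_three_of_liftThree : LiftThree → LiftBeta0 3 (-3) :=
  fun h W _ ρ hρ hirr h9 hmod _ _ _ _ ↦ h W ρ hρ hirr (by simpa using h9) hmod

/-- No costume: `β₀(5)` is a weakening of the registered `stub_liftFive`. -/
theorem liftBeta0_five_of_liftFive : LiftFive → LiftBeta0 5 5 :=
  fun h W _ ρ hρ hirr h25 hmod _ _ _ _ ↦ h W ρ hρ hirr (by simpa using h25) hmod

/-! ## C1. Arithmetic certificate of the triple `27 + 3098 = 3125` -/

/-- `(a, b, c) = (27, 3098, 3125)`: coprime, `abc ≠ 0`, `v₃(abc) = 3` (`27 ∣`, `81 ∤`),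
`v₅(abc) = 5` (`3125 ∣`, `15625 ∤`), `2 ∥ b` (additive at `2`: allowed, the stubs are
Diamond-1996-strength away from `ℓ`), `1549` prime to `30`. -/
theorem doubleBeta0_witness_arith :
    IsCoprime (27 : ℤ) 3098 ∧ (27 : ℤ) * 3098 * (27 + 3098) = 261393750 ∧
      (27 : ℤ) * 3098 * (27 + 3098) ≠ 0 ∧
      (27 : ℤ) ∣ 261393750 ∧ ¬ (81 : ℤ) ∣ 261393750 ∧
      (3125 : ℤ) ∣ 261393750 ∧ ¬ (15625 : ℤ) ∣ 261393750 ∧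
      (2 : ℤ) ∣ 3098 ∧ ¬ (4 : ℤ) ∣ 3098 := by
  refine ⟨?_, by norm_num⟩
  rw [Int.isCoprime_iff_gcd_eq_one]; decide

/-- `v₃(abc) = 3` as a `padicValInt`. -/
theorem padicValInt_three_abc : padicValInt 3 ((27 : ℤ) * 3098 * (27 + 3098)) = 3 := by
  have e : ((27 : ℤ) * 3098 * (27 + 3098)).natAbs = 3 ^ 3 * 9681250 := by decide
  rw [padicValInt, e, padicValNat.mul (by decide) (by decide), padicValNat.prime_pow,
    padicValNat.eq_zero_of_not_dvd (by decide)]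

/-- `v₅(abc) = 5` as a `padicValInt`. -/
theorem padicValInt_five_abc : padicValInt 5 ((27 : ℤ) * 3098 * (27 + 3098)) = 5 := by
  have e : ((27 : ℤ) * 3098 * (27 + 3098)).natAbs = 5 ^ 5 * 83646 := by decide
  rw [padicValInt, e, padicValNat.mul (by decide) (by decide), padicValNat.prime_pow,
    padicValNat.eq_zero_of_not_dvd (by decide)]

/-! ## C2. `E_(27,3098)` lies in `β₀(3)` AND in `β₀(5)` -/

/-- **`E_(27,3098) ∈ β₀(3)`**: multiplicative at the place above `3` with `ord₃ Δ_min = 2·3 = 6`.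
[cite: Serre1987, §4.1 (4.1.2), (4.1.9)] -/
theorem freyCurve_doubleBeta0_at_three (v : HeightOneSpectrum ℤ) (hv : natGenerator v = 3) :
    (freyCurve 27 3098).HasMultiplicativeReductionAt v ∧
      (freyCurve 27 3098).ordMinimalDiscriminant v = 6 ∧
      3 ∣ (freyCurve 27 3098).ordMinimalDiscriminant v := by
  have hab : IsCoprime (27 : ℤ) 3098 := doubleBeta0_witness_arith.1
  have h0 : (27 : ℤ) * 3098 * (27 + 3098) ≠ 0 := by norm_num
  have h2 : natGenerator v ≠ 2 := by rw [hv]; decide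
  have hord : (freyCurve 27 3098).ordMinimalDiscriminant v = 6 := by
    rw [ordMinimalDiscriminant_freyCurve_of_ne_two hab h0 v h2, hv, padicValInt_three_abc]
  refine ⟨hasMultiplicativeReductionAt_freyCurve_of_ne_two hab h0 v h2 (by rw [hv]; norm_num),
    hord, ?_⟩
  rw [hord]; decide

/-- **`E_(27,3098) ∈ β₀(5)`**: multiplicative at the place above `5` with `ord₅ Δ_min = 2·5 = 10`.
[cite: Serre1987, §4.1 (4.1.2), (4.1.9)] -/
theorem freyCurve_doubleBeta0_at_five (v : HeightOneSpectrum ℤ) (hv : natGenerator v = 5) :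
    (freyCurve 27 3098).HasMultiplicativeReductionAt v ∧
      (freyCurve 27 3098).ordMinimalDiscriminant v = 10 ∧
      5 ∣ (freyCurve 27 3098).ordMinimalDiscriminant v := by
  have hab : IsCoprime (27 : ℤ) 3098 := doubleBeta0_witness_arith.1
  have h0 : (27 : ℤ) * 3098 * (27 + 3098) ≠ 0 := by norm_num
  have h2 : natGenerator v ≠ 2 := by rw [hv]; decide
  have hord : (freyCurve 27 3098).ordMinimalDiscriminant v = 10 := by
    rw [ordMinimalDiscriminant_freyCurve_of_ne_two hab h0 v h2, hv, padicValInt_five_abc]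
  refine ⟨hasMultiplicativeReductionAt_freyCurve_of_ne_two hab h0 v h2 (by rw [hv]; norm_num),
    hord, ?_⟩
  rw [hord]; decide

/-- The remaining cheap hypotheses of BOTH stubs for `E_(27,3098)`: elliptic, `9 ∤ N`, `25 ∤ N`
(`N ∣ 2⁸ · rad(abc)`, squarefree radical), and framings of `E[3]`, `E[5]` exist.  (`hirr` at `3`
is NOT certified here — `3 ∣ abc` and `5 ∣ abc` silence both Frobenius certificates R3/E8 — and is
not needed: in case A the curve meets `β₀(3)` through `stub_liftThree`, in case B it meets `β₀(5)`
through `stub_liftFive`; `ρ̄_{E,5}|ℚ(√5)` abs. irreducible holds for every Frey curve by the landed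
`isIrreducible_freyCurve_five` ∘ `stub_absIrrSqrtFive`.) -/
theorem freyCurve_doubleBeta0_stub_hypotheses :
    (freyCurve 27 3098).IsElliptic ∧ ¬ 9 ∣ (freyCurve 27 3098).conductorNorm ℤ ∧
      ¬ 25 ∣ (freyCurve 27 3098).conductorNorm ℤ ∧
      (∃ ρ : ModPGaloisRep ℚ (ZMod 3) 2, (freyCurve 27 3098).IsTorsionGaloisRep 3 ρ) ∧
      (∃ ρ : ModPGaloisRep ℚ (ZMod 5) 2, (freyCurve 27 3098).IsTorsionGaloisRep 5 ρ) := by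
  have hab : IsCoprime (27 : ℤ) 3098 := doubleBeta0_witness_arith.1
  have h0 : (27 : ℤ) * 3098 * (27 + 3098) ≠ 0 := by norm_num
  haveI := isElliptic_freyCurve h0
  have h25 : ¬ 25 ∣ (freyCurve 27 3098).conductorNorm ℤ := by
    intro h25
    have hdvd := conductorNorm_freyCurve_dvd_holds 27 3098 hab h0
    have h25' : 25 ∣ 2 ^ 8 * (UniqueFactorizationMonoid.radical ((27 : ℤ) * 3098 * (27 + 3098))).natAbs :=
      h25.trans hdvd
    have hcop : Nat.Coprime 25 (2 ^ 8) := by norm_num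
    have h25r := hcop.dvd_of_dvd_mul_left h25'
    have hsq : Squarefree (UniqueFactorizationMonoid.radical ((27 : ℤ) * 3098 * (27 + 3098))).natAbs :=
      Int.squarefree_natAbs.mpr UniqueFactorizationMonoid.squarefree_radical
    have hu : IsUnit (5 : ℕ) := hsq 5 ((show (5 : ℕ) * 5 = 25 by norm_num) ▸ h25r)
    exact absurd (Nat.isUnit_iff.mp hu) (by norm_num)
  exact ⟨inferInstance, not_nine_dvd_conductorNorm_freyCurve hab h0, h25,
    (freyCurve 27 3098).exists_isTorsionGaloisRep 3, (freyCurve 27 3098).exists_isTorsionGaloisRep 5⟩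

/-! ## C3. The Hasse-interval arithmetic behind the `a₃`-rigidity of the `3`–`5` switch

For `E, E'` semistable at `3` with `E[5] ≅ E'[5]`: if `E` is good at `3` then `E'[5]` is unramified
at `3`, so `E'` is good at `3` with `a₃(E') ≡ a₃(E) (mod 5)` or multiplicative with
`a₃(E) ≡ ±(3+1) (mod 5)` (Tate curve); `|a₃| ≤ 2√3 < 4`.  The two finite facts below are what turns
these congruences into equalities: `a₃(E) = 0 ⇒ a₃(E') = 0` (the flat supersingular cell `α` is
inherited by every switch curve) and "good `E` admits a multiplicative switch partner only if
`a₃(E) = ∓1`" (never for a Frey curve, which is never good-ordinary at `3`). -/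

/-- `{a ∈ [-3, 3] : a ≡ 0 (mod 5)} = {0}` and `{a ∈ [-3, 3] : a ≡ a' (mod 5), a' ∈ [-3,3]}`:
congruent Hasse-range traces at `p = 3` are equal unless they differ by `5`, which inside
`[-3, 3]` happens only for `{-3, 2}` and `{-2, 3}` — never for `0`. [folklore] -/
theorem hasse_three_mod_five_rigid :
    (∀ a ∈ Finset.Icc (-3 : ℤ) 3, (5 : ℤ) ∣ a → a = 0) ∧
    (∀ a ∈ Finset.Icc (-3 : ℤ) 3, ∀ a' ∈ Finset.Icc (-3 : ℤ) 3, (5 : ℤ) ∣ a - a' →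
      a = a' ∨ (a = -3 ∧ a' = 2) ∨ (a = 2 ∧ a' = -3) ∨ (a = -2 ∧ a' = 3) ∨ (a = 3 ∧ a' = -2)) := by
  constructor <;> decide

/-- `{a ∈ [-3, 3] : a ≡ ±4 (mod 5)} = {∓1}`: a curve good at `3` whose `5`-torsion matches that of
a curve multiplicative at `3` has `a₃ = ±1` (good ORDINARY) — so a supersingular curve (`3 ∣ a₃`)
has no multiplicative switch partner, and a Frey curve (never good-ordinary at `3`) that is good at
`3` has only good supersingular partners. [folklore] -/
theorem hasse_three_tate_trace_rigid :
    ∀ a ∈ Finset.Icc (-3 : ℤ) 3, ((5 : ℤ) ∣ a - 4 ∨ (5 : ℤ) ∣ a + 4) ↔ (a = 1 ∨ a = -1) := by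
  decide

/-! ## C4. The `q = ℓ` increment, GLOBAL side, in LANDED Selmer-structure currency (gen-12 H12.3 (R))

In the tree's dialect (`DiscreteGaloisModule.sigmaSelmerStructure ρ S L`, the k2-lane currency) the
condition ABOVE `p` is the parameter `L : LocalConditionsAbove p`, not `S`-membership: DDT's
"`ℓ ∈ Σ`" (`L_{Σ,ℓ} = H¹_ss`) vs "`ℓ ∉ Σ`" (`L_{Σ,ℓ} = H¹_f`) is `L = L_ss` (`greenberg`) vs
`L = L_f` (`BlochKatoDatum.LocalConditionsAbove.ofDatum`), same `S`.  The two structures agree OFF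
the places above `p`, so the tree's PROVED `SelmerStructure.natCard_quotient_selmerGroup_le_prod`
(Mazur–Rubin Lemma 2.3.5) gives the global half of the increment at `q = ℓ` for free; what is left
is the LOCAL index `#(H¹_ss/H¹_f)(ℚ_ℓ, ad⁰ρ_f ⊗ λ⁻ⁿ/O) ≤ #O/(λⁿ, c_ℓ)` (DDT Prop. 2.27(b),
Lemma 2.29(a): `c_ℓ = (χ₁/χ₂)(Frob_ℓ) − 1`) — `LocalIndexAboveBound` below is its typed slot.
k2-g7 typed the analogue for `q ≠ p` only (`natCard_sigmaSelmerGroup_quotient_le_prod`, `SigmaStep`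
"for every finite `Σ ⊆ Σ_ρ̄ ∖ {p}`"). -/

section C4

universe u

open Literature.NumberTheory.GaloisRepresentations.DiscreteGaloisModule

variable {K : Type u} [Field K] [NumberField K] {M : Type u} [AddCommGroup M] [TopologicalSpace M]
  [DiscreteTopology M]

/-- **H13.1 (PROVED, S): the `Σ`-increment ABOVE `p`, global side.**  For one `S` and two
conditions `L_f, L_ss` above `p`, with `T ⊇ {v ∣ p}` and finite local quotients
`L_ss(v)/L_f(v) ∩ L_ss(v)`:
`#(H¹_{S,L_ss}(K, M) / H¹_{S,L_f} ∩ H¹_{S,L_ss}) ≤ ∏_{v ∈ T} #(𝓛_ss(v) / 𝓛_f(v) ∩ 𝓛_ss(v))`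
(for `L_f ≤ L_ss`: `[H¹_ss : H¹_f] ≤ ∏_{v ∣ p} [L_ss(v) : L_f(v)]`; at `v ∣ p` the structure IS
`L v hv`, `sigmaSelmerStructure_inr_of_mem`).  DDT (2.?) p. 98 "`#H¹_Σ' ≤ #H¹_Σ · ∏_{p ∈ Σ'−Σ} #H_p`"
with `ℓ ∈ Σ' − Σ`. [cite: DarmonDiamondTaylor1995, Prop. 3.35 and p. 97 (`H_ℓ`)]
[cite: MazurRubinMemoirs2004, Lemma 2.3.5] -/
theorem natCard_sigmaSelmerGroup_quotient_le_prod_above (p : ℕ) (ρ : DiscreteGaloisModule K M)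
    (S : Set (HeightOneSpectrum (𝓞 K))) (Lf Lss : ρ.LocalConditionsAbove p)
    (T : Finset (HeightOneSpectrum (𝓞 K))) (hT : ∀ v, ((p : ℕ) : 𝓞 K) ∈ v.asIdeal → v ∈ T)
    (hfin : ∀ v ∈ T, Finite (↥(ρ.sigmaSelmerStructure p S Lss (Sum.inr v)) ⧸
      (ρ.sigmaSelmerStructure p S Lf (Sum.inr v)).addSubgroupOf
        (ρ.sigmaSelmerStructure p S Lss (Sum.inr v)))) :
    Nat.card (↥(ρ.sigmaSelmerGroup p S Lss) ⧸
        (ρ.sigmaSelmerGroup p S Lf).addSubgroupOf (ρ.sigmaSelmerGroup p S Lss)) ≤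
      ∏ v ∈ T, Nat.card (↥(ρ.sigmaSelmerStructure p S Lss (Sum.inr v)) ⧸
        (ρ.sigmaSelmerStructure p S Lf (Sum.inr v)).addSubgroupOf
          (ρ.sigmaSelmerStructure p S Lss (Sum.inr v))) := by
  classical
  have hoff : ∀ v ∉ T.map Function.Embedding.inr,
      ρ.sigmaSelmerStructure p S Lss v ≤ ρ.sigmaSelmerStructure p S Lf v := by
    intro v hv
    rcases v with w | v
    · simp [DiscreteGaloisModule.sigmaSelmerStructure]
    · have hvT : v ∉ T := fun h' => hv (Finset.mem_map.mpr ⟨v, h', rfl⟩)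
      have hp : ((p : ℕ) : 𝓞 K) ∉ v.asIdeal := fun h' => hvT (hT v h')
      by_cases hS : v ∈ S
      · rw [sigmaSelmerStructure_inr_of_mem_S _ _ _ hp hS,
          sigmaSelmerStructure_inr_of_mem_S _ _ _ hp hS]
      · rw [sigmaSelmerStructure_inr_of_not_mem _ _ _ hp hS,
          sigmaSelmerStructure_inr_of_not_mem _ _ _ hp hS]
  have hfin' : ∀ v ∈ T.map Function.Embedding.inr,
      Finite (↥(ρ.sigmaSelmerStructure p S Lss v) ⧸
        (ρ.sigmaSelmerStructure p S Lf v).addSubgroupOf (ρ.sigmaSelmerStructure p S Lss v)) := by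
    intro v hv
    obtain ⟨v', hv', rfl⟩ := Finset.mem_map.mp hv
    exact hfin v' hv'
  have h := SelmerStructure.natCard_quotient_selmerGroup_le_prod (ρ.sigmaSelmerStructure p S Lf)
    (ρ.sigmaSelmerStructure p S Lss) (T.map Function.Embedding.inr) hoff hfin'
  rw [Finset.prod_map] at h
  exact h

/-- **H13.2 slot (OPEN, L — the genuinely local content of the `q = ℓ` step): a bound `B v` for
the local index above `p`.**  DDT's value for `M = ad⁰ρ_f ⊗ λ⁻ⁿ/O`, `ρ_f` good AND ordinary at
`ℓ`, `L_f =` finite ("good") classes, `L_ss =` Greenberg classes: `B = #O/(λⁿ, c_ℓ)`,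
`c_ℓ = (χ₁/χ₂)(Frob_ℓ) − 1 ≠ 0` (Prop. 2.27(b) via Fontaine–Laffaille Prop. 2.28 + Lemma 2.29(a);
T-side match `φ_T φ'_T = −(α_ℓ − ℓα_ℓ⁻¹)(1 − α_ℓ⁻²)`, p. 133).  Uniform in `ℓ`: the route consumes
it at `ℓ = 3` (cell `β₀(3)`, `E_(1,26)`) or at `ℓ = 5` (cell `β₀(5)`), see C2.
[cite: DarmonDiamondTaylor1995, Prop. 2.27(b), Lemma 2.29(a), p. 133] -/
def LocalIndexAboveBound (p : ℕ) (ρ : DiscreteGaloisModule K M) (Lf Lss : ρ.LocalConditionsAbove p)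
    (B : ∀ v : HeightOneSpectrum (𝓞 K), ((p : ℕ) : 𝓞 K) ∈ v.asIdeal → ℕ) : Prop :=
  ∀ (v : HeightOneSpectrum (𝓞 K)) (hv : ((p : ℕ) : 𝓞 K) ∈ v.asIdeal),
    Finite (↥(Lss v hv) ⧸ (Lf v hv).addSubgroupOf (Lss v hv)) ∧
      Nat.card (↥(Lss v hv) ⧸ (Lf v hv).addSubgroupOf (Lss v hv)) ≤ B v hv

/-- **H13.3 (PROVED, XS): composition over a field with ONE place `w` above `p` (e.g. `K = ℚ`):**
`[H¹_{S,L_ss} : H¹_{S,L_f} ∩ H¹_{S,L_ss}] ≤ B w` — H13.1 with `T = {w}` + the slot H13.2. -/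
theorem natCard_sigmaSelmerGroup_quotient_le_of_unique_above (p : ℕ) (ρ : DiscreteGaloisModule K M)
    (S : Set (HeightOneSpectrum (𝓞 K))) (Lf Lss : ρ.LocalConditionsAbove p)
    (B : ∀ v : HeightOneSpectrum (𝓞 K), ((p : ℕ) : 𝓞 K) ∈ v.asIdeal → ℕ)
    (hB : LocalIndexAboveBound p ρ Lf Lss B)
    (w : HeightOneSpectrum (𝓞 K)) (hw : ((p : ℕ) : 𝓞 K) ∈ w.asIdeal)
    (huniq : ∀ v : HeightOneSpectrum (𝓞 K), ((p : ℕ) : 𝓞 K) ∈ v.asIdeal → v = w) :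
    Nat.card (↥(ρ.sigmaSelmerGroup p S Lss) ⧸
        (ρ.sigmaSelmerGroup p S Lf).addSubgroupOf (ρ.sigmaSelmerGroup p S Lss)) ≤ B w hw := by
  classical
  have key : ∀ L : ρ.LocalConditionsAbove p, ρ.sigmaSelmerStructure p S L (Sum.inr w) = L w hw :=
    fun L => sigmaSelmerStructure_inr_of_mem ρ S L hw
  have hfin : ∀ v ∈ ({w} : Finset (HeightOneSpectrum (𝓞 K))),
      Finite (↥(ρ.sigmaSelmerStructure p S Lss (Sum.inr v)) ⧸
        (ρ.sigmaSelmerStructure p S Lf (Sum.inr v)).addSubgroupOf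
          (ρ.sigmaSelmerStructure p S Lss (Sum.inr v))) := by
    intro v hv
    rw [Finset.mem_singleton] at hv
    subst hv
    rw [key Lss, key Lf]
    exact (hB v hw).1
  refine (natCard_sigmaSelmerGroup_quotient_le_prod_above p ρ S Lf Lss {w}
    (fun v hv => Finset.mem_singleton.mpr (huniq v hv)) hfin).trans ?_
  rw [Finset.prod_singleton, key Lss, key Lf]
  exact (hB w hw).2

end C4

end Summit.ABC.ABC.Cruxes.FreyModularity.StubIdeas3G13

end
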